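import Literature.AlgebraicGeometry.Resolution.QuadraticTransformWeakTransform
import Mathlib.FieldTheory.Perfect
import Mathlib.RingTheory.Derivation.Basic
import HarnessLib

/-!
# Crux `FolLU` (stmt-ResolutionOfSingularities-17081), line `birth` — a separable regular
# parameter at the centre of the first chart (`stub_sepParam`)

Route `ResolutionOfSingularities/FoliationDescent`, the low-dimensional engine of the lead's
skeleton (`Cruxes/FolLU/Lines/birth.lean`, v9/v10), stub `stub_sepParam`: the one place where
perfectness of the residue field enters.

SETTING. `R ⊆ K` a two-dimensional regular local ring with regular system of parameters
`𝔪 = (x, y)` and PERFECT residue field `κ`, dominated by the valuation ring `O`, with `y/x ∈ O`;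
`𝒜 = R[y/x]` (`chartAdjoin x y`) the first chart of the blowing up of the closed point,
`Q = 𝔪_O ∩ 𝒜` the centre of `O` on it (`subringCentre`) and `R₁ = 𝒜_Q = locAtCentre 𝒜 O`,
assumed regular of dimension two; `D` a derivation of `K` with `D(R) ⊆ R·Dx + R·Dy`.

CLAIM (`stub_sepParam`). `𝔪_{R₁} = (x, y₁)` for some `y₁` with `D y₁ = u·D(y/x) + e·Dx`, `u` a
unit of `R₁`, `e ∈ R₁`.

PROOF. Reduction of coefficients `ρ : R[X] → κ[X]` and evaluation followed by reduction
`R[X] → 𝒜 → 𝒜/Q` have comparable kernels (a polynomial with coefficients in `𝔪` evaluates into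
`𝔪𝒜 = x𝒜 ⊆ Q`, `map_maximalIdeal_chartIncl`), whence a ring map `θ : κ[X] → 𝒜/Q`
(`RingHom.liftOfSurjective`); its kernel `𝔭` is a prime of the principal ideal domain `κ[X]`,
nonzero because `Q ≠ x𝒜` (else `𝔪_{R₁} = x R₁` would be principal, impossible in dimension two,
`maximalIdeal_ne_span_singleton`), so `𝔭 = (g)` with `g` prime, hence irreducible, hence
SEPARABLE (`PerfectField.separable_of_irreducible`), i.e. `g' ∉ 𝔭`. For a lift `P ∈ R[X]` of
`g`, `y₁ := P(y/x)` lies in `Q`, `P'(y/x) ∉ Q`, and `Q = (x, y₁)𝒜`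
(`exists_polynomial_centre`), so `𝔪_{R₁} = Q R₁ = (x, y₁) R₁`
(`IsLocalization.AtPrime.map_eq_maximalIdeal`). Finally the Leibniz rule
(`derivation_aeval`: `D(F(t)) = F'(t)·Dt + Σ (D cᵢ) tⁱ`) together with `D cᵢ = aᵢ Dx + bᵢ Dy`
and `Dy = x·Dt + t·Dx` (`t = y/x`) gives `D y₁ = (P'(t) + x·s)·Dt + e·Dx` with `s, e ∈ 𝒜`
(`exists_derivation_aeval_eq`), and `u = P'(t) + x·s ∉ Q` is a unit of `R₁ = 𝒜_Q`
(`IsLocalization.map_units`).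

References: J. Giraud, *Forme normale d'une fonction sur une surface de caractéristique
positive*, Bull. SMF 111 (1983), 2.5 ("quitte à passer à un revêtement étale"); C. Huneke,
I. Swanson, *Integral Closure of Ideals, Rings, and Modules* (2006), §14.2 (`S/xS ≅ k[t]`).
Definition-free; kernel-only.
-/

set_option linter.dupNamespace false -- mandated namespace of this single-conjunct summit

noncomputable section

namespace Summit.ResolutionOfSingularities.ResolutionOfSingularities.Theorems.FolLU.SepParam

open Literature.AlgebraicGeometry.Resolution IsLocalRing Polynomial

universe u

variable {K : Type u} [Field K]

/-! ## Leibniz for a polynomial expression -/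

/-- **Leibniz rule for a polynomial expression under a `ℤ`-derivation of a field**: for
`F = Σ cᵢ Xⁱ ∈ R[X]` (`R ⊆ K`) and `t ∈ K`, `D(F(t)) = F'(t)·D t + Σᵢ D(cᵢ)·tⁱ` — the
coefficients are differentiated too, `D` being only additive. [folklore] -/
theorem derivation_aeval (D : Derivation ℤ K K) (R : Subring K) (t : K) (F : R[X]) :
    D (aeval t F) = aeval t (derivative F) * D t + F.sum (fun i c => D (c : K) * t ^ i) := by
  induction F using Polynomial.induction_on' with
  | add p q hp hq =>
    rw [map_add, map_add, derivative_add, map_add, hp, hq,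
      Polynomial.sum_add_index p q _ (fun i => by simp) (fun i b₁ b₂ => by
        rw [Subring.coe_add, map_add, add_mul])]
    ring
  | monomial n c =>
    rw [derivative_monomial, aeval_monomial, aeval_monomial,
      Polynomial.sum_monomial_index c _ (by simp), Derivation.leibniz, Derivation.leibniz_pow]
    simp only [map_mul, map_natCast, Algebra.algebraMap_ofSubsemiring_apply, smul_eq_mul,
      nsmul_eq_mul]
    ring

/-- **Transport of `D(R) ⊆ R·Dx + R·Dy` to the chart `R[y/x]`**: if every `f ∈ R` has
`D f = a_f·Dx + b_f·Dy` then for `F ∈ R[X]` and `t = y/x`,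
`D(F(t)) = (F'(t) + x·s)·Dt + e·Dx` with `s, e ∈ R[y/x]` (namely `s = Σ bᵢ tⁱ`,
`e = Σ (aᵢ + bᵢ t) tⁱ`, using `Dy = x·Dt + t·Dx`). [folklore] -/
theorem exists_derivation_aeval_eq (D : Derivation ℤ K K) (R : Subring K) {x y : R}
    (hx0 : ((x : R) : K) ≠ 0) {a b : R → R}
    (hab : ∀ f : R, D (f : K) = (a f : K) * D (x : K) + (b f : K) * D (y : K)) (F : R[X]) :
    ∃ s ∈ chartAdjoin (K := K) x y, ∃ e ∈ chartAdjoin (K := K) x y,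
      D (aeval (((y : R) : K) / ((x : R) : K)) F) =
        (aeval (((y : R) : K) / ((x : R) : K)) (derivative F) + (x : K) * s) *
            D (((y : R) : K) / ((x : R) : K)) + e * D ((x : R) : K) := by
  classical
  set t : K := ((y : R) : K) / ((x : R) : K) with ht
  have htA : t ∈ chartAdjoin (K := K) x y := Algebra.self_mem_adjoin_singleton R t
  have hRA : R ≤ chartAdjoin (K := K) x y := subring_le_adjoin R t
  have hyt : ((y : R) : K) = (x : K) * t := by rw [ht]; field_simp
  have hDy : D ((y : R) : K) = (x : K) * D t + t * D (x : K) := by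
    rw [hyt, Derivation.leibniz, smul_eq_mul, smul_eq_mul]
  refine ⟨∑ i ∈ F.support, ((b (F.coeff i) : R) : K) * t ^ i, ?_,
    ∑ i ∈ F.support, (((a (F.coeff i) : R) : K) + ((b (F.coeff i) : R) : K) * t) * t ^ i, ?_, ?_⟩
  · exact Subring.sum_mem _ fun i _ => Subring.mul_mem _ (hRA (b _).2) (Subring.pow_mem _ htA i)
  · exact Subring.sum_mem _ fun i _ => Subring.mul_mem _
      (Subring.add_mem _ (hRA (a _).2) (Subring.mul_mem _ (hRA (b _).2) htA))
      (Subring.pow_mem _ htA i)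
  · rw [derivation_aeval, Polynomial.sum_def]
    have key : ∀ i ∈ F.support, D ((F.coeff i : R) : K) * t ^ i =
        (x : K) * (((b (F.coeff i) : R) : K) * t ^ i) * D t +
          (((a (F.coeff i) : R) : K) + ((b (F.coeff i) : R) : K) * t) * t ^ i * D (x : K) := by
      intro i _
      rw [hab, hDy]
      ring
    rw [Finset.sum_congr rfl key, Finset.sum_add_distrib, ← Finset.sum_mul, ← Finset.sum_mul,
      ← Finset.mul_sum]
    ring

/-! ## The centre on the exceptional line is cut out by a separable polynomial -/

/-- **The centre of the chart is cut out, on the exceptional line `𝒜/x𝒜 ≅ κ[X]`, by a separable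
polynomial.** Let `(R, 𝔪 = (x, y))` be a local subring of `K` (`x ≠ 0`) with perfect residue
field `κ`, `𝒜 = R[y/x]`, and `Q` a prime of `𝒜` containing `x` but not contained in `x𝒜`. Then
there is `P ∈ R[X]` with `P(y/x) ∈ Q`, `P'(y/x) ∉ Q` and `Q = (x, P(y/x))𝒜`: the reduction of
`P` is the prime (separable, `κ` being perfect) generator of the kernel of `κ[X] → 𝒜/Q`.
[folklore] -/
theorem exists_polynomial_centre (R : Subring K) [IsLocalRing R] [PerfectField (ResidueField R)]
    {x y : R} (hm : maximalIdeal R = Ideal.span {x, y}) (hx0 : x ≠ 0)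
    (h : ∀ F : R[X], (aeval (((y : R) : K) / ((x : R) : K))).toRingHom F ∈
      (Algebra.adjoin R {((y : R) : K) / ((x : R) : K)}).toSubring)
    (Q : Ideal (chartAdjoin (K := K) x y)) [Q.IsPrime] (hxQ : chartIncl x y x ∈ Q)
    (hQx : ¬ Q ≤ Ideal.span {chartIncl x y x}) :
    ∃ P : R[X],
      (aeval (((y : R) : K) / ((x : R) : K))).toRingHom.codRestrict _ h P ∈ Q ∧
      (aeval (((y : R) : K) / ((x : R) : K))).toRingHom.codRestrict _ h (derivative P) ∉ Q ∧
      Q = Ideal.span {chartIncl x y x,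
        (aeval (((y : R) : K) / ((x : R) : K))).toRingHom.codRestrict _ h P} := by
  classical
  set t : K := ((y : R) : K) / ((x : R) : K) with ht
  set ψ : R[X] →+* chartAdjoin (K := K) x y := (aeval t).toRingHom.codRestrict _ h with hψ
  have hψsurj : Function.Surjective ψ := aevalCod_surjective R t h
  -- polynomials with coefficients in `𝔪` evaluate into `𝔪𝒜 = x𝒜`
  have hcoef : ∀ F : R[X], (∀ i, F.coeff i ∈ maximalIdeal R) →
      ψ F ∈ Ideal.span {chartIncl (K := K) x y x} := by
    intro F hF
    rw [← map_maximalIdeal_chartIncl hm hx0]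
    exact aeval_mem_map_incl_of_coeff_mem hF
  have hxspan : Ideal.span {chartIncl (K := K) x y x} ≤ Q :=
    (Ideal.span_singleton_le_iff_mem _).mpr hxQ
  -- reduction of coefficients
  set ρ : R[X] →+* (ResidueField R)[X] := mapRingHom (residue R) with hρ
  have hρsurj : Function.Surjective ρ := Polynomial.map_surjective _ residue_surjective
  have hρzero : ∀ F : R[X], ρ F = 0 ↔ ∀ i, F.coeff i ∈ maximalIdeal R := by
    intro F
    rw [Polynomial.ext_iff]
    refine forall_congr' fun i => ?_
    rw [hρ, coe_mapRingHom, coeff_map, coeff_zero, residue_eq_zero_iff]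
  -- `θ : κ[X] → 𝒜/Q` with `θ ∘ ρ = (mod Q) ∘ ψ`
  set φ : R[X] →+* (chartAdjoin (K := K) x y ⧸ Q) := (Ideal.Quotient.mk Q).comp ψ with hφ
  have hker : RingHom.ker ρ ≤ RingHom.ker φ := by
    intro F hF
    rw [RingHom.mem_ker] at hF ⊢
    rw [hφ, RingHom.comp_apply, Ideal.Quotient.eq_zero_iff_mem]
    exact hxspan (hcoef F ((hρzero F).mp hF))
  set θ : (ResidueField R)[X] →+* (chartAdjoin (K := K) x y ⧸ Q) :=
    ρ.liftOfSurjective hρsurj ⟨φ, hker⟩ with hθ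
  have hθρ : ∀ F : R[X], θ (ρ F) = Ideal.Quotient.mk Q (ψ F) := fun F =>
    ρ.liftOfSurjective_comp_apply hρsurj ⟨φ, hker⟩ F
  have hmemker : ∀ F : R[X], ρ F ∈ RingHom.ker θ ↔ ψ F ∈ Q := by
    intro F
    rw [RingHom.mem_ker, hθρ, Ideal.Quotient.eq_zero_iff_mem]
  -- its kernel `𝔭` is a nonzero prime of the PID `κ[X]`
  set 𝔭 : Ideal (ResidueField R)[X] := RingHom.ker θ with h𝔭
  haveI h𝔭prime : 𝔭.IsPrime := RingHom.ker_isPrime θ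
  have h𝔭ne : 𝔭 ≠ ⊥ := by
    intro hbot
    apply hQx
    intro f hf
    obtain ⟨F, rfl⟩ := hψsurj f
    have h1 : ρ F ∈ 𝔭 := (hmemker F).mpr hf
    rw [hbot, Ideal.mem_bot] at h1
    exact hcoef F ((hρzero F).mp h1)
  set g : (ResidueField R)[X] := Submodule.IsPrincipal.generator 𝔭 with hg
  have hg𝔭 : Ideal.span {g} = 𝔭 := Ideal.span_singleton_generator 𝔭
  have hgmem : g ∈ 𝔭 := Submodule.IsPrincipal.generator_mem 𝔭
  have hgprime : Prime g := Submodule.IsPrincipal.prime_generator_of_isPrime 𝔭 h𝔭ne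
  -- `g` is separable (perfect residue field): `g' ∉ 𝔭`
  have hsep : g.Separable := PerfectField.separable_of_irreducible hgprime.irreducible
  have hg' : derivative g ∉ 𝔭 := by
    intro hd
    obtain ⟨c, d, hcd⟩ := hsep
    apply h𝔭prime.ne_top
    rw [Ideal.eq_top_iff_one, ← hcd]
    exact 𝔭.add_mem (𝔭.mul_mem_left _ hgmem) (𝔭.mul_mem_left _ hd)
  -- lift `g` to `P ∈ R[X]`
  obtain ⟨P, hP⟩ := hρsurj g
  have hPQ : ψ P ∈ Q := (hmemker P).mp (hP ▸ hgmem)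
  refine ⟨P, hPQ, ?_, ?_⟩
  · intro hd
    apply hg'
    have e : derivative g = ρ (derivative P) := by
      rw [← hP, hρ, coe_mapRingHom, derivative_map]
    rw [e]
    exact (hmemker _).mpr hd
  · apply le_antisymm
    · intro f hf
      obtain ⟨F, rfl⟩ := hψsurj f
      have h1 : ρ F ∈ Ideal.span {g} := hg𝔭 ▸ (hmemker F).mpr hf
      obtain ⟨H', hH'⟩ := Ideal.mem_span_singleton'.mp h1
      obtain ⟨H, rfl⟩ := hρsurj H'
      have h2 : ρ (F - H * P) = 0 := by
        rw [map_sub, map_mul, hP, hH', sub_self]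
      have h3 := hcoef _ ((hρzero _).mp h2)
      rw [map_sub, map_mul] at h3
      obtain ⟨c, hc⟩ := Ideal.mem_span_singleton'.mp h3
      rw [Ideal.mem_span_pair]
      exact ⟨c, ψ H, by rw [hc]; ring⟩
    · rw [Ideal.span_le]
      rintro _ (rfl | rfl)
      exacts [hxQ, hPQ]

/-! ## Assembly at the local ring of the centre -/

/-- **A separable regular parameter at the centre of the chart** (the content of
`stub_sepParam`, with `R₁ = locAtCentre (R[y/x]) O` substituted): `𝔪_{R₁} = (x, y₁)` with
`D y₁ = u·D(y/x) + e·Dx`, `u` a unit of `R₁`. [folklore] -/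
theorem exists_param (O : ValuationSubring K) (D : Derivation ℤ K K) (R : Subring K)
    [IsRegularLocalRing R] (hdim : ringKrullDim R = 2) (hdom : SubringDominates R O.toSubring)
    [PerfectField (ResidueField R)] {x y : R} (hm : maximalIdeal R = Ideal.span {x, y})
    (hval : ∀ f : R, ∃ a b : R, D (f : K) = (a : K) * D (x : K) + (b : K) * D (y : K))
    (hyx : ((y : R) : K) / ((x : R) : K) ∈ O)
    [IsRegularLocalRing (locAtCentre (chartAdjoin (K := K) x y) O)]
    (hdim₁ : ringKrullDim (locAtCentre (chartAdjoin (K := K) x y) O) = 2) :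
    ∃ (x₁ y₁ u e : locAtCentre (chartAdjoin (K := K) x y) O), (x₁ : K) = x ∧
      maximalIdeal (locAtCentre (chartAdjoin (K := K) x y) O) = Ideal.span {x₁, y₁} ∧
      IsUnit u ∧
      D (y₁ : K) = (u : K) * D (((y : R) : K) / ((x : R) : K)) + (e : K) * D (x : K) := by
  classical
  have hx2 : x ∉ maximalIdeal R ^ 2 := fst_not_mem_sq hdim hm
  have hx0 : x ≠ 0 := by
    rintro rfl
    exact hx2 (Ideal.zero_mem _)
  have hx0K : ((x : R) : K) ≠ 0 := fun e => hx0 (Subtype.ext e)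
  have hxm : x ∈ maximalIdeal R := hm ▸ Ideal.subset_span (by simp)
  set t : K := ((y : R) : K) / ((x : R) : K) with ht
  have hmem : ∀ F : R[X], (aeval t).toRingHom F ∈ (Algebra.adjoin R {t}).toSubring :=
    fun _ => aeval_mem_adjoin_singleton R t
  set ψ : R[X] →+* chartAdjoin (K := K) x y := (aeval t).toRingHom.codRestrict _ hmem with hψ
  have hAO : chartAdjoin (K := K) x y ≤ O.toSubring := adjoin_toSubring_le hdom.1 hyx
  -- the centre `Q` of `O` on the chart, and `R₁ = 𝒜_Q`
  set Q : Ideal (chartAdjoin (K := K) x y) := subringCentre (chartAdjoin (K := K) x y) O hAO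
    with hQ
  haveI := isLocalization_locAtCentre hAO
  have hxQ : chartIncl (K := K) x y x ∈ Q := by
    rw [hQ, mem_subringCentre_iff]
    exact ((subringDominates_valuationSubring_iff hdom.1).mp hdom x).mp hxm
  have hmax : Q.map (algebraMap (chartAdjoin (K := K) x y) (locAtCentre (chartAdjoin (K := K) x y) O))
      = maximalIdeal (locAtCentre (chartAdjoin (K := K) x y) O) :=
    IsLocalization.AtPrime.map_eq_maximalIdeal Q _
  -- `Q ≠ x𝒜`, for `𝔪_{R₁}` is not principal
  have hQx : ¬ Q ≤ Ideal.span {chartIncl (K := K) x y x} := by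
    intro hle
    have hQeq : Q = Ideal.span {chartIncl (K := K) x y x} :=
      le_antisymm hle ((Ideal.span_singleton_le_iff_mem _).mpr hxQ)
    apply maximalIdeal_ne_span_singleton hdim₁
      (algebraMap (chartAdjoin (K := K) x y) (locAtCentre (chartAdjoin (K := K) x y) O)
        (chartIncl (K := K) x y x))
    rw [← hmax, hQeq, Ideal.map_span, Set.image_singleton]
  obtain ⟨P, hPQ, hP'Q, hQspan⟩ := exists_polynomial_centre R hm hx0 hmem Q hxQ hQx
  -- the derivative of `y₁ = P(t)`
  choose a b hab using hval
  obtain ⟨s, hs, e, he, hse⟩ := exists_derivation_aeval_eq D R hx0K hab P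
  have huQ : ψ (derivative P) + chartIncl (K := K) x y x * ⟨s, hs⟩ ∉ Q := by
    intro hu
    apply hP'Q
    have e1 : ψ (derivative P) =
        (ψ (derivative P) + chartIncl (K := K) x y x * ⟨s, hs⟩) -
          chartIncl (K := K) x y x * ⟨s, hs⟩ := by ring
    rw [e1]
    exact Q.sub_mem hu (Q.mul_mem_right _ hxQ)
  refine ⟨algebraMap _ _ (chartIncl (K := K) x y x), algebraMap _ _ (ψ P),
    algebraMap _ _ (ψ (derivative P) + chartIncl (K := K) x y x * ⟨s, hs⟩),
    algebraMap _ _ (⟨e, he⟩ : chartAdjoin (K := K) x y), rfl, ?_, ?_, ?_⟩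
  · rw [← hmax, hQspan, Ideal.map_span, Set.image_pair]
  · exact IsLocalization.map_units (M := Q.primeCompl) _ ⟨_, huQ⟩
  · show D (aeval t P) = ((aeval t (derivative P) : K) + (x : K) * s) * D t + e * D (x : K)
    exact hse

end Summit.ResolutionOfSingularities.ResolutionOfSingularities.Theorems.FolLU.SepParam

namespace Summit.ResolutionOfSingularities.ResolutionOfSingularities.Theorems.FolLU

open Literature.AlgebraicGeometry.Resolution IsLocalRing

/-- **A regular parameter at the centre of the chart with unit derivative** (registered stub
`stub_sepParam` of line `birth`; the one place where perfectness of the residue field enters the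
engine). `R ⊆ K` two-dimensional regular local with `𝔪 = (x, y)` and PERFECT residue field,
dominated by `O`, `y/x ∈ O`, `R₁ = (R[y/x])_{𝔪_O ∩ R[y/x]}` (assumed regular of dimension two),
`D` any derivation of `K` with `D(R) ⊆ R·Dx + R·Dy`. Then `𝔪_{R₁} = (x, y₁)` for some `y₁` with
`D y₁ = u · D(y/x) + e · Dx`, `u` a UNIT of `R₁`, `e ∈ R₁`: `y₁ = P(y/x)` for a lift `P` of the
separable irreducible polynomial cutting out the centre on the exceptional line `κ[X]`
(`SepParam.exists_polynomial_centre`, `SepParam.exists_param`).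
[folklore; cf. Giraud1983, 2.5] -/
theorem stub_sepParam :
    ∀ (K : Type) [Field K] (O : ValuationSubring K) (D : Derivation ℤ K K)
    (R : Subring K) [IsRegularLocalRing R], ringKrullDim R = 2 →
    SubringDominates R O.toSubring → PerfectField (ResidueField R) →
    ∀ (x y : R), maximalIdeal R = Ideal.span {x, y} →
    (∀ f : R, ∃ a b : R, D (f : K) = (a : K) * D (x : K) + (b : K) * D (y : K)) →
    ((y : R) : K) / ((x : R) : K) ∈ O →
    ∀ (R₁ : Subring K) [IsRegularLocalRing R₁], R₁ = locAtCentre (chartAdjoin (K := K) x y) O →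
    ringKrullDim R₁ = 2 →
    ∃ (x₁ y₁ u e : R₁), (x₁ : K) = x ∧ maximalIdeal R₁ = Ideal.span {x₁, y₁} ∧ IsUnit u ∧
      D (y₁ : K) = (u : K) * D (((y : R) : K) / ((x : R) : K)) + (e : K) * D (x : K) := by
  intro K _ O D R _ hdim hdom hperf x y hm hval hyx R₁ _ hR₁ hdim₁
  subst hR₁
  haveI := hperf
  exact SepParam.exists_param O D R hdim hdom hm hval hyx hdim₁

end Summit.ResolutionOfSingularities.ResolutionOfSingularities.Theorems.FolLU
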